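import Summits.SmoothPoincare4.SmoothPoincare4.Theorems.ConvexBisectionPlanarBisectionExistsSupport

/-!
# `PlanarBisectionExists` — support: the planar pair closes the summit

The place of the item
`Summit.SmoothPoincare4.SmoothPoincare4.Theses.ConvexBisection.PlanarBisectionExists`
(stmt-SmoothPoincare4-10512) in route ConvexBisection: together with the crux
`PlanarBisectionRigidity` (stmt-SmoothPoincare4-10511) it is a SECOND DECIDING PAIR of the route
(beside `AcyclicBisectionExists` + `AcyclicBisectionRigidity` of the route's `closes`):

* `smoothPoincare4_of_planar_pair : PlanarBisectionExists → PlanarBisectionRigidity →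
  SmoothPoincare4` (pure logic: the item supplies the planar Stein bisection that the crux turns
  into a diffeomorphism);
* `planarBisectionRigidity_of_smoothPoincare4` (the crux's conclusion is the summit's);
* `smoothPoincare4_iff_planar_pair_of` — modulo the planarity `hP` of the standard contact `S³`
  (as in `Theorems/ConvexBisectionPlanarBisectionExistsSupport.lean`), `SmoothPoincare4 ↔
  PlanarBisectionExists ∧ PlanarBisectionRigidity`: the pair carries no slack.
-/

noncomputable section

-- the prescribed namespace `Summit.<P>.<Sub>.…` duplicates `SmoothPoincare4` (P = Sub)
set_option linter.dupNamespace false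

open scoped Manifold ContDiff Topology ContinuousMap
open Set Function
open Literature.Geometry.Symplectic Literature.Topology.FourManifolds

namespace Summit.SmoothPoincare4.SmoothPoincare4.Theorems.PlanarBisectionExists

open Summit.SmoothPoincare4.SmoothPoincare4.Theses.ConvexBisection
open Summit.SmoothPoincare4.SmoothPoincare4.Theorems.AcyclicBisectionExists.Negative

/-- **The planar pair is a deciding pair**: `PlanarBisectionExists → PlanarBisectionRigidity →
SmoothPoincare4` — every homotopy 4-sphere has a planar Stein bisection (the item), and every
homotopy 4-sphere with one is standard (crux stmt-SmoothPoincare4-10511). Pure logic. [folklore] -/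
theorem smoothPoincare4_of_planar_pair (hE : PlanarBisectionExists) (hR : PlanarBisectionRigidity) :
    _root_.SmoothPoincare4 := by
  intro M _ _ _ _ _ e
  obtain ⟨B, hP, -⟩ := planarBisectionExists_iff.1 hE M e
  exact hR M e ⟨B.W₁, inferInstance, inferInstance, inferInstance, inferInstance, B.W₂,
    inferInstance, inferInstance, inferInstance, inferInstance, B.J₁, B.J₂, B.e₁, B.e₂, B.emb₁,
    B.emb₂, B.cover, B.inter₁, B.inter₂, B.contact, hP⟩

/-- The rigidity half is implied by the summit (its conclusion is the summit's). [folklore] -/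
theorem planarBisectionRigidity_of_smoothPoincare4 (hs : _root_.SmoothPoincare4) :
    PlanarBisectionRigidity := by
  intro M _ _ _ _ _ e _
  exact hs M ‹_› ‹_› e

/-- **No slack in the planar pair** (modulo the planarity `hP` of the standard contact `S³`):
`SmoothPoincare4 ↔ PlanarBisectionExists ∧ PlanarBisectionRigidity`. [folklore] -/
theorem smoothPoincare4_iff_planar_pair_of (hP : PlanarContactBoundary steinStructureClosedBall) :
    _root_.SmoothPoincare4 ↔ PlanarBisectionExists ∧ PlanarBisectionRigidity :=
  ⟨fun hs => ⟨planarBisectionExists_of_smoothPoincare4_of hP hs,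
    planarBisectionRigidity_of_smoothPoincare4 hs⟩,
    fun h => smoothPoincare4_of_planar_pair h.1 h.2⟩

end Summit.SmoothPoincare4.SmoothPoincare4.Theorems.PlanarBisectionExists
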